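import Mathlib
import HarnessLib
import Summits.HubbardSuperconductivity.HubbardSuperconductivity.Theorems.KLProgrammeKLRegimeKernelNormsLevelsDefs
import Summits.HubbardSuperconductivity.HubbardSuperconductivity.Theorems.KLProgrammeKLRegimeWickEffectiveActionLegDressing

/-!
# Route `KLProgramme` — ENGINE child gen 6 (stmt-HubbardSuperconductivity-20236 `KLRegimeEngineV16`), `stub_engine_step_values` (E2-v10):
# the SUPPORT bridge between the value/norm forms (`prescribedTuples univ`) and the engine's kernel norms (`prescribedTuples (bgmSectorSet …)`)
# (cell gate-hubbard-kl, seat p5 g5)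

Every value / norm form of the cross-contraction lane (p5 g4's `…WickCrossContractionValue/Sized`, p5 g5's `…Gram*`) asks for the sectorised norms of
the vertices on `prescribedTuples univ Ωe`, while the engine's (E1) / (E1-F) / (E1-W) carriers `klAnisoLegKernelNorm`, `klAnisoLegKernelNormAt`,
`klWickAnisoLegKernelNormAt` are the same norms on the momentum-conserving tuples `prescribedTuples (bgmSectorSet …) Ωe` — a SMALLER set.  The two agree for
momentum-conserving polynomials: the sectorised kernels of such a `G` vanish on every sector tuple outside `bgmSectorSet` (BGM 2006, after (2.71)).

* `sectorisedKernel_eq_zero_of_not_mem_bgmSectorSet` — momentum conservation of the kernels of `G` ⇒ `W_Ω ≡ 0` for `Ω ∉ bgmSectorSet F m`;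
* `sectorLegSum_le_of_vanish`, `sectorisedKernelNorm_le_of_vanish` — a norm over `A'` is at most the norm over `A` if the kernels vanish on `A' ∖ A`;
* **`hubbardSectorKernelNorm_le_of_bgmSectorSet`**, **`hubbardSectorKernelNorm_prescribed_univ_le`** — for momentum-conserving `G`:
  `‖G‖_{F, A'} ≤ ‖G‖_{F, A}` whenever `A' ∩ bgmSectorSet ⊆ A`; in particular `‖G‖_{F, prescribedTuples univ Ωe} ≤ ‖G‖_{F, prescribedTuples (bgmSectorSet F m) Ωe}`;
* model (momentum conservation of `𝒱_n`/`𝒲_n` coordinatewise: `kernel_klEffectiveAction_eq_zero_of_momentum` p510092, `kernel_klWickAction_eq_zero_of_momentum`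
  p495253): `klEffectiveAction_momentumConserving`, `klWickAction_momentumConserving` (the signed-momentum form of `bgmSectorSet`), and the two readings
  **`hubbardSectorKernelNorm_prescribed_univ_le_klAnisoLegKernelNormAt`** / **`…_le_klWickAnisoLegKernelNormAt`** — the hypotheses `hNa/hNb` of the
  value/norm forms are discharged BY NAME from `KernelNormsV4` / `KernelNormsLevels` / their Wick twins.

Proved; no definitions, no named facts.
-/

noncomputable section

namespace Summit.HubbardSuperconductivity.HubbardSuperconductivity.Theorems.KLRegimeWick

set_option linter.dupNamespace false -- summit = problem name (single-conjunct summit), D-0017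

open Literature.MathematicalPhysics.QuantumLattice Literature.Probability.LatticeModels GrassmannAlgebra Finset Matrix
open Summit.HubbardSuperconductivity.HubbardSuperconductivity.Theorems.KLRegimeSplit
open Summit.HubbardSuperconductivity.HubbardSuperconductivity.Theorems.KLProgrammeLegKernels
open Summit.HubbardSuperconductivity.HubbardSuperconductivity.Theorems.TwoPointAssembly

/-! ## §1 Generic: vanishing outside `bgmSectorSet` and the norm comparison -/

section Generic

variable {L M N : ℕ} [NeZero L]

/-- **The sectorised kernels of a momentum-conserving polynomial vanish outside `bgmSectorSet`.** [folklore] -/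
theorem sectorisedKernel_eq_zero_of_not_mem_bgmSectorSet (β : ℝ) (F : Fin N → FreqMomentum L M → ℂ) (G : HubbardGrassmann L M)
    (hG : ∀ (m : ℕ) (K : Fin m → HubbardFieldIdx L M), ∑ i, signedMomentum L (K i).2 (K i).1.1.2 ≠ 0 → kernel ℂ G m K = 0)
    {m : ℕ} {Ω : Fin m → SectorLeg N} (hΩ : Ω ∉ bgmSectorSet L M F m) (x : Fin m → SpaceTimeIdx L M) :
    sectorisedKernel L M β F G m Ω x = 0 := by
  classical
  rw [sectorisedKernel_def]
  refine sum_eq_zero fun k _ => ?_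
  by_cases hF : ∀ i, F (Ω i).1.1 (k i) ≠ 0
  · have hsum : ∑ i, signedMomentum L (Ω i).2 (k i).2 ≠ 0 := fun h => hΩ ((mem_bgmSectorSet F Ω).2 ⟨k, hF, h⟩)
    rw [hG m _ (by simpa using hsum), mul_zero]
  · push Not at hF
    obtain ⟨i, hi⟩ := hF
    rw [prod_eq_zero (mem_univ i) (by rw [hi, zero_mul]), zero_mul]

omit [NeZero L] in
/-- A leg sum over `A'` is at most the leg sum over `A` if the kernels vanish on `A' ∖ A` (`ε ≥ 0`). [folklore] -/
theorem sectorLegSum_le_of_vanish {P S : Type*} [Fintype P] [Fintype S] [DecidableEq P] [DecidableEq S] {𝕜 : Type*} [RCLike 𝕜] {ε : ℝ}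
    (hε : 0 ≤ ε) {m : ℕ} {A A' : Finset (Fin (m + 1) → S)} (W : (Fin (m + 1) → S) → (Fin (m + 1) → P) → 𝕜)
    (hW : ∀ Ω ∈ A', Ω ∉ A → ∀ X, W Ω X = 0) (p : Fin (m + 1)) (s : S) (x : P) :
    sectorLegSum ε A' W p s x ≤ sectorLegSum ε A W p s x := by
  rw [sectorLegSum_def, sectorLegSum_def, ← sum_filter_add_sum_filter_not (A'.filter fun Ω => Ω p = s) (fun Ω => Ω ∈ A)]
  have hzero : ∑ Ω ∈ (A'.filter fun Ω => Ω p = s).filter (fun Ω => Ω ∉ A),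
      ε ^ m * ∑ X ∈ univ.filter (fun X : Fin (m + 1) → P => X p = x), ‖W Ω X‖ = 0 := by
    refine sum_eq_zero fun Ω hΩ => ?_
    simp only [mem_filter] at hΩ
    rw [sum_eq_zero fun X _ => by rw [hW Ω hΩ.1.1 hΩ.2 X, norm_zero], mul_zero]
  rw [hzero, add_zero]
  refine sum_le_sum_of_subset_of_nonneg (fun Ω hΩ => ?_) fun _ _ _ => mul_nonneg (pow_nonneg hε _) (sum_nonneg fun _ _ => norm_nonneg _)
  simp only [mem_filter] at hΩ ⊢
  exact ⟨hΩ.2, hΩ.1.2⟩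

omit [NeZero L] in
/-- **The sectorised norm over `A'` is at most the norm over `A` if the kernels vanish on `A' ∖ A`.** [folklore] -/
theorem sectorisedKernelNorm_le_of_vanish {P S : Type*} [Fintype P] [Fintype S] [DecidableEq P] [DecidableEq S] {𝕜 : Type*} [RCLike 𝕜] {ε : ℝ}
    (hε : 0 ≤ ε) : ∀ {m : ℕ} {A A' : Finset (Fin m → S)} (W : (Fin m → S) → (Fin m → P) → 𝕜),
      (∀ Ω ∈ A', Ω ∉ A → ∀ X, W Ω X = 0) → sectorisedKernelNorm ε m A' W ≤ sectorisedKernelNorm ε m A W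
  | 0, A, A', W, hW => by
    classical
    change ∑ Ω ∈ A', ‖W Ω Fin.elim0‖ ≤ ∑ Ω ∈ A, ‖W Ω Fin.elim0‖
    rw [← sum_filter_add_sum_filter_not A' (fun Ω => Ω ∈ A)]
    have hzero : ∑ Ω ∈ A'.filter (fun Ω => Ω ∉ A), ‖W Ω Fin.elim0‖ = 0 :=
      sum_eq_zero fun Ω hΩ => by
        simp only [mem_filter] at hΩ
        rw [hW Ω hΩ.1 hΩ.2, norm_zero]
    rw [hzero, add_zero]
    exact sum_le_sum_of_subset_of_nonneg (fun Ω hΩ => (mem_filter.1 hΩ).2) fun _ _ _ => norm_nonneg _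
  | m + 1, A, A', W, hW =>
    sectorisedKernelNorm_le_of_forall_le (sectorisedKernelNorm_nonneg hε _ _ _) fun p s x =>
      (sectorLegSum_le_of_vanish hε W hW p s x).trans (sectorLegSum_le_sectorisedKernelNorm ε A W p s x)

/-- **Norm comparison for momentum-conserving `G`**: if `A' ∩ bgmSectorSet ⊆ A` then `‖G‖_{F,A'} ≤ ‖G‖_{F,A}` (`β ≥ 0`). [folklore] -/
theorem hubbardSectorKernelNorm_le_of_bgmSectorSet {β : ℝ} (hβ : 0 ≤ β) (F : Fin N → FreqMomentum L M → ℂ) (G : HubbardGrassmann L M)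
    (hG : ∀ (m : ℕ) (K : Fin m → HubbardFieldIdx L M), ∑ i, signedMomentum L (K i).2 (K i).1.1.2 ≠ 0 → kernel ℂ G m K = 0)
    {m : ℕ} {A A' : Finset (Fin m → SectorLeg N)} (hA : ∀ Ω ∈ A', Ω ∈ bgmSectorSet L M F m → Ω ∈ A) :
    hubbardSectorKernelNorm L M β F A' G ≤ hubbardSectorKernelNorm L M β F A G := by
  rw [hubbardSectorKernelNorm_def, hubbardSectorKernelNorm_def]
  exact sectorisedKernelNorm_le_of_vanish (imagTimeWeight_nonneg hβ M) _ fun Ω hΩ' hΩA x =>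
    sectorisedKernel_eq_zero_of_not_mem_bgmSectorSet β F G hG (fun h => hΩA (hA Ω hΩ' h)) x

/-- **Prescriptions**: `‖G‖_{F, prescribedTuples univ Ωe} ≤ ‖G‖_{F, prescribedTuples (bgmSectorSet F m) Ωe}` for momentum-conserving `G`. [folklore] -/
theorem hubbardSectorKernelNorm_prescribed_univ_le {β : ℝ} (hβ : 0 ≤ β) (F : Fin N → FreqMomentum L M → ℂ) (G : HubbardGrassmann L M)
    (hG : ∀ (m : ℕ) (K : Fin m → HubbardFieldIdx L M), ∑ i, signedMomentum L (K i).2 (K i).1.1.2 ≠ 0 → kernel ℂ G m K = 0)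
    {m : ℕ} (Ωe : Fin m → Option (SectorLeg N)) :
    hubbardSectorKernelNorm L M β F (prescribedTuples univ Ωe) G ≤ hubbardSectorKernelNorm L M β F (prescribedTuples (bgmSectorSet L M F m) Ωe) G :=
  hubbardSectorKernelNorm_le_of_bgmSectorSet hβ F G hG fun Ω hΩ hbgm => by
    rw [prescribedTuples, mem_filter] at hΩ ⊢
    exact ⟨hbgm, hΩ.2⟩

end Generic

/-! ## §2 Model: `𝒱_n` and `𝒲_n` conserve momentum; the readings against (E1)/(E1-F)/(E1-W) -/

section Model

variable {L M : ℕ} [NeZero L] [NeZero M]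

omit [NeZero L] [NeZero M] in
/-- A signed momentum evaluated at a coordinate is `±` the coordinate. -/
theorem signedMomentum_apply (c : Fin 2) (k : TorusSite 2 L) (j : Fin 2) :
    signedMomentum L c k j = (if c = 0 then (1 : ℤ) else -1) • k j := by
  rw [signedMomentum]
  split_ifs <;> simp

omit [NeZero L] [NeZero M] in
/-- From the vector form `Σ signedMomentum ≠ 0` to one coordinate. -/
theorem exists_coord_ne_zero_of_sum_signedMomentum_ne_zero {m : ℕ} (K : Fin m → HubbardFieldIdx L M)
    (h : ∑ i, signedMomentum L (K i).2 (K i).1.1.2 ≠ 0) :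
    ∃ j : Fin 2, ∑ i, (if (K i).2 = 0 then (1 : ℤ) else -1) • (K i).1.1.2 j ≠ 0 := by
  by_contra hall
  push Not at hall
  apply h
  funext j
  rw [Finset.sum_apply, Pi.zero_apply]
  simp_rw [signedMomentum_apply]
  exact hall j

/-- **`𝒱_n` is momentum-conserving** in the signed-momentum form of `bgmSectorSet`. -/
theorem klEffectiveAction_momentumConserving (β U μ : ℝ) (K : TrigPolyC4v) (e₀ : ℝ) (n : ℕ) (m : ℕ) (X : Fin m → HubbardFieldIdx L M)
    (h : ∑ i, signedMomentum L (X i).2 (X i).1.1.2 ≠ 0) : kernel ℂ (klEffectiveAction L M β U μ K e₀ n) m X = 0 := by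
  obtain ⟨j, hj⟩ := exists_coord_ne_zero_of_sum_signedMomentum_ne_zero X h
  exact kernel_klEffectiveAction_eq_zero_of_momentum β U μ K e₀ n j hj

/-- **`𝒲_n` is momentum-conserving** in the signed-momentum form of `bgmSectorSet`. -/
theorem klWickAction_momentumConserving (β U μ : ℝ) (K : TrigPolyC4v) (n : ℕ) (m : ℕ) (X : Fin m → HubbardFieldIdx L M)
    (h : ∑ i, signedMomentum L (X i).2 (X i).1.1.2 ≠ 0) : kernel ℂ (klWickAction L M β U μ K n) m X = 0 := by
  obtain ⟨j, hj⟩ := exists_coord_ne_zero_of_sum_signedMomentum_ne_zero X h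
  exact kernel_klWickAction_eq_zero_of_momentum β U μ K n j hj

/-- **Reading against (E1)/(E1-F)**: for every prescription,
`‖𝒱_n‖_{klAnisoFamily n, prescribedTuples univ Ωe} ≤ klAnisoLegKernelNormAt … n m Ωe` — the `Na`/`Nb` hypotheses of the value/norm forms are discharged by
`KernelNormsV4` (`Ωe = none`, `klAnisoLegKernelNormAt_none`) and `KernelNormsLevels`. -/
theorem hubbardSectorKernelNorm_prescribed_univ_le_klAnisoLegKernelNormAt {β : ℝ} (hβ : 0 ≤ β) (U μ : ℝ) (K : TrigPolyC4v) (e₀ : ℝ)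
    (n m : ℕ) (Ωe : Fin m → Option (SectorLeg (sectorCount n))) :
    hubbardSectorKernelNorm L M β (klAnisoFamily L M β μ K e₀ n) (prescribedTuples univ Ωe) (klEffectiveAction L M β U μ K e₀ n) ≤
      klAnisoLegKernelNormAt L M β U μ K e₀ n m Ωe :=
  hubbardSectorKernelNorm_prescribed_univ_le hβ _ _ (klEffectiveAction_momentumConserving β U μ K e₀ n) Ωe

/-- **Reading against (E1-W)**: `‖𝒲_n‖_{klAnisoFamily n, prescribedTuples univ Ωe} ≤ klWickAnisoLegKernelNormAt … n m Ωe`. -/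
theorem hubbardSectorKernelNorm_prescribed_univ_le_klWickAnisoLegKernelNormAt {β : ℝ} (hβ : 0 ≤ β) (U μ : ℝ) (K : TrigPolyC4v)
    (n m : ℕ) (Ωe : Fin m → Option (SectorLeg (sectorCount n))) :
    hubbardSectorKernelNorm L M β (klAnisoFamily L M β μ K klE0 n) (prescribedTuples univ Ωe) (klWickAction L M β U μ K n) ≤
      klWickAnisoLegKernelNormAt L M β U μ K n m Ωe :=
  hubbardSectorKernelNorm_prescribed_univ_le hβ _ _ (klWickAction_momentumConserving β U μ K n) Ωe

end Model

end Summit.HubbardSuperconductivity.HubbardSuperconductivity.Theorems.KLRegimeWick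

end
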